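import Mathlib
import Summits.MatrixMultiplication.MatrixMultiplication.Theorems.SevenEighthsLaw.Negative.SharpConstants

/-!
# `SevenEighthsLaw` — negative-side lemmas, cycle 2 (cdisprove seat refuter-cdisprove-…-4959-g2-0)

Two kernel-checked facts about the crux `SevenEighthsLaw` (`M(2,6) = 7`: no rank-≤6 tensor captures more
than `7/8` of `T = ⟨2,2,2⟩`), complementing `SharpConstants.lean` (p75228):

* `sevenEighthsLaw_biniS2_deficit` / `_biniS2_below` — BORDER-SIDE TANGENCY.  On the two-parameter
  Bini-plus-honest family `biniS2 m k = m·(Bini order-one scheme for ⟨2,2,2⟩ ∖ a₂₂) + k·(a₂₂⊗b₂₁⊗c₁₂)`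
  (honest integer tensors of rank `≤ 6`; `biniS m = biniS2 m m`) one has exactly
  `7·‖S‖² − ⟨S,T⟩² = 6(m − k)² + 28 > 0`: the border mechanism "border-rank-5 scheme for six units + one
  honest unit" reaches the constant `7` only as `m → ∞` and only tangentially at `k = m` (limiting ratio
  `(6+t)²/(6+t²) = 7 − 6(t−1)²/(6+t²)`, `t = k/m`).  So this family never fires the kill switch
  `sevenEighthsLaw_not_of_int`, and a certificate of the law must be second-order tight there too.
* `sevenEighthsLaw_isotopeNegOne_false` — ISOTOPE SENSITIVITY.  The same bound is FALSE for
  `T₋₁ := T − 2·z₂₂⊗x₂₂⊗y₂₂` (the structure tensor of the isotope `e₂₂·e₂₂ = −e₂₂`; same support, same torus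
  weights, same norm `√8` as `T`): an honest integer rank-≤6 witness has `⟨S,T₋₁⟩² = 2892² > 7·1188253 =
  7‖S‖²` (ratio `7.0386`; numerically the supremum is `≥ 7.2057`, a border value).  Hence support, torus
  weights, flattening spectra and "border rank 7" (shared by the unimodular pencil `T_χ`, numerically) cannot
  prove the law: a proof must use the sign structure (associativity) of `⟨2,2,2⟩`.  Numerically the tight set
  `{χ : M(T_χ) = 7}` of the pencil `T_χ = T + (χ−1)E` is a convex region meeting the unit circle only at
  `χ = 1`, with `M(e^{iθ}) ≈ 7 + 0.016·θ²` (Cruxes/SevenEighthsLaw/Disproof.lean § (g)).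
-/

namespace Summit.MatrixMultiplication.MatrixMultiplication.Theorems

open scoped BigOperators
open Literature.Computability.AlgebraicComplexity

namespace SevenEighthsLawNeg

/-- X-slot factors of the Bini-plus-honest family with the honest sixth product weighted `k`.
[cite: BiniEtAl1979] -/
def biniU2 (m k : ℤ) : Fin 6 → P2 → ℤ :=
  ![m • e 0 1 + e 0 0, m • e 1 0 + e 0 0, -(m • e 0 1), -(m • e 1 0), e 0 1 + e 1 0, k • e 1 1]

/-- `biniS2 m k`: Bini's five-product order-one scheme (weight `m`) plus the honest product
`k · a₂₂ ⊗ b₂₁ ⊗ c₁₂`. [cite: BiniEtAl1979] -/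
def biniS2 (m k : ℤ) : P2 → P2 → P2 → ℤ := fun a b c => ∑ r, biniW m r a * biniU2 m k r b * biniV m r c

/-- Honest rank `≤ 6`. [cite: BiniEtAl1979] -/
theorem tensorRank_biniS2_le (m k : ℤ) : tensorRank (biniS2 m k) ≤ 6 :=
  tensorRank_le_of_eq_sum (biniW m) (biniU2 m k) (biniV m)
    (by funext a b c; simp [biniS2, Finset.sum_apply, triad_apply])

/-- Overlap `6m + k`. [folklore] -/
theorem overlapZ_biniS2 (m k : ℤ) : overlapZ (biniS2 m k) = 6 * m + k := by
  simp [overlapZ, biniS2, biniW, biniU2, biniV, e, matMulTensor, Fintype.sum_prod_type,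
    Fin.sum_univ_succ]
  ring

/-- Squared norm `6m² + k² + 4`. [folklore] -/
theorem normSqZ_biniS2 (m k : ℤ) : normSqZ (biniS2 m k) = 6 * m ^ 2 + k ^ 2 + 4 := by
  simp [normSqZ, biniS2, biniW, biniU2, biniV, e, Fintype.sum_prod_type, Fin.sum_univ_succ]
  ring

/-- `T₋₁ = ⟨2,2,2⟩ − 2·z₂₂⊗x₂₂⊗y₂₂` over `ℤ`. [folklore] -/
def isoT : P2 → P2 → P2 → ℤ := fun a b c =>
  matMulTensor ℤ 2 2 2 a b c - 2 * (if a = (1, 1) ∧ b = (1, 1) ∧ c = (1, 1) then 1 else 0)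

/-- Overlap of two integer tensors. [folklore] -/
def overlapZW (Sz Tz : P2 → P2 → P2 → ℤ) : ℤ := ∑ a, ∑ b, ∑ c, Sz a b c * Tz a b c

/-- Overlap of integer tensors read over `ℂ`. [folklore] -/
theorem overlap_castT₂ (Sz Tz : P2 → P2 → P2 → ℤ) :
    (∑ a, ∑ b, ∑ c, castT Sz a b c * castT Tz a b c) = (overlapZW Sz Tz : ℂ) := by
  unfold overlapZW castT; push_cast; rfl

/-- `isoT` read over `ℂ` is `⟨2,2,2⟩ − 2·z₂₂⊗x₂₂⊗y₂₂`. [folklore] -/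
theorem castT_isoT : castT isoT = fun a b c =>
    matMulTensor ℂ 2 2 2 a b c - 2 * (if a = (1, 1) ∧ b = (1, 1) ∧ c = (1, 1) then 1 else 0) := by
  funext a b c
  unfold castT isoT matMulTensor
  split_ifs <;> push_cast <;> norm_num

/-- Z-slot factors of the honest integer rank-6 witness for `T₋₁` (real ALS + rounding + greedy integer
polish; entries `≤ 12`). [folklore] -/
def isoW : Fin 6 → P2 → ℤ :=
  ![vec4 3 (-12) 0 3, vec4 5 (-12) (-2) (-2), vec4 (-3) (-11) 0 (-2), vec4 3 (-11) 2 (-4),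
    vec4 3 8 (-3) (-7), vec4 5 8 3 (-3)]
/-- X-slot factors of the `T₋₁` witness. [folklore] -/
def isoU : Fin 6 → P2 → ℤ :=
  ![vec4 (-4) 2 11 3, vec4 2 2 (-12) (-5), vec4 6 3 8 (-3), vec4 3 0 11 3, vec4 2 (-1) (-10) 3,
    vec4 (-4) 2 (-8) 6]
/-- Y-slot factors of the `T₋₁` witness. [folklore] -/
def isoV : Fin 6 → P2 → ℤ :=
  ![vec4 (-2) 3 10 (-7), vec4 3 0 12 (-4), vec4 (-3) (-2) (-9) (-4), vec4 6 (-3) 10 2,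
    vec4 4 2 (-8) 4, vec4 (-2) 0 10 2]
/-- `isoS = Σ_r isoW r ⊗ isoU r ⊗ isoV r`. [folklore] -/
def isoS : P2 → P2 → P2 → ℤ := fun a b c => ∑ r, isoW r a * isoU r b * isoV r c

/-- The integer rank certificate `R(isoS) ≤ 6`. [folklore] -/
theorem tensorRank_isoS_le : tensorRank isoS ≤ 6 :=
  tensorRank_le_of_eq_sum isoW isoU isoV (by funext a b c; simp [isoS, Finset.sum_apply, triad_apply])

/-- `⟨isoS, T₋₁⟩ = 2892`, `‖isoS‖² = 1188253` (`2892² = 8363664 > 8317771 = 7·1188253`). [folklore] -/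
theorem isoS_vals : overlapZW isoS isoT = 2892 ∧ normSqZ isoS = 1188253 := by decide

end SevenEighthsLawNeg

open SevenEighthsLawNeg

/-- **Border-side deficit identity** on the two-parameter Bini-plus-honest family:
`7‖S‖² − ⟨S,⟨2,2,2⟩⟩² = 6(m − k)² + 28`. [folklore] -/
theorem sevenEighthsLaw_biniS2_deficit (m k : ℤ) :
    7 * normSqZ (biniS2 m k) - overlapZ (biniS2 m k) ^ 2 = 6 * (m - k) ^ 2 + 28 := by
  rw [overlapZ_biniS2, normSqZ_biniS2]; ring

/-- Hence every member of the family obeys `SevenEighthsLaw` STRICTLY (in the crux's own terms): honest rank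
`≤ 6` and `|⟨S,T⟩|² < 7‖S‖²`; the value `7` is reached only in the limit `m → ∞`, `k/m → 1`. [folklore] -/
theorem sevenEighthsLaw_biniS2_below (m k : ℤ) : ∃ S : P2 → P2 → P2 → ℂ, tensorRank S ≤ 6 ∧
    ‖∑ a, ∑ b, ∑ c, S a b c * matMulTensor ℂ 2 2 2 a b c‖ ^ 2 = ((6 * m + k) ^ 2 : ℤ) ∧
    (∑ a, ∑ b, ∑ c, ‖S a b c‖ ^ 2) = ((6 * m ^ 2 + k ^ 2 + 4 : ℤ) : ℝ) ∧
    ‖∑ a, ∑ b, ∑ c, S a b c * matMulTensor ℂ 2 2 2 a b c‖ ^ 2 < 7 * ∑ a, ∑ b, ∑ c, ‖S a b c‖ ^ 2 := by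
  refine ⟨castT (biniS2 m k), (tensorRank_castT_le _).trans (tensorRank_biniS2_le m k), ?_, ?_, ?_⟩
  · rw [(ratio_castT _).1, overlapZ_biniS2]
  · rw [(ratio_castT _).2, normSqZ_biniS2]
  · rw [(ratio_castT _).1, (ratio_castT _).2]
    have h := sevenEighthsLaw_biniS2_deficit m k
    rw [overlapZ_biniS2, normSqZ_biniS2] at h ⊢
    have : (6 * m + k) ^ 2 < 7 * (6 * m ^ 2 + k ^ 2 + 4) := by nlinarith [sq_nonneg (m - k)]
    exact_mod_cast this

/-- **Isotope sensitivity**: the `SevenEighthsLaw`-shaped bound is FALSE for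
`T₋₁ = ⟨2,2,2⟩ − 2·z₂₂⊗x₂₂⊗y₂₂` (same support, torus weights and norm as `⟨2,2,2⟩`): an honest rank-≤6
tensor has fidelity `> 7/8` with it.  Any proof of the crux must therefore use more than support, weights,
flattening spectra and border rank. [folklore] -/
theorem sevenEighthsLaw_isotopeNegOne_false : ¬ (∀ S : P2 → P2 → P2 → ℂ, tensorRank S ≤ 6 →
    ‖∑ a, ∑ b, ∑ c, S a b c *
        (matMulTensor ℂ 2 2 2 a b c - 2 * (if a = (1, 1) ∧ b = (1, 1) ∧ c = (1, 1) then 1 else 0))‖ ^ 2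
      ≤ 7 * ∑ a, ∑ b, ∑ c, ‖S a b c‖ ^ 2) := by
  intro h
  have key := h (castT isoS) ((tensorRank_castT_le _).trans tensorRank_isoS_le)
  have hc := castT_isoT
  simp only [funext_iff] at hc
  simp_rw [← hc] at key
  rw [overlap_castT₂, (ratio_castT isoS).2, isoS_vals.1, isoS_vals.2, Complex.norm_intCast] at key
  norm_num at key

end Summit.MatrixMultiplication.MatrixMultiplication.Theorems
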